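import Summits.Ventures.Crystal3D.Bulk.CapBoxCasteljau
import Summits.Ventures.Crystal3D.Bulk.CapBoxTensor
import HarnessLib

/-!
# Tensor-Bernstein branch and bound: soundness of the search

Venture `Crystal3D` (cell `pub-crystal3d`, phase 2; seat typer-bulk). Continuation of `CapBoxTensor.lean`:
shapes are preserved by the splits, the values of the two children along each axis
(`val3N_splitL0 … val3N_splitR2`: `val3 (child) (2s) = 2ⁿ · val3 (parent) (s)` etc.), the sign tests
(`le_val3N_of_allGe3`, `val3N_lt_of_allLt3`) and the soundness of the search `bnb_sound`:
on a certified node, wherever in the unit cube the Gram tensor's value is `≥ η`, the target tensor's value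
is `≥ θ`. HONEST FRAMING: bookkeeping [folklore]; nothing geometric.
-/

open Finset

namespace Summit.Ventures.Crystal3D.CapCut.Bern

/-! ### The functionals of the three levels are linear -/

/-- Level 0 (naturals). [folklore] -/
theorem lin0 : IsLin2 (fun x : ℕ => (x : ℝ)) 0 Nat.add sc0 where
  zero := by simp
  add := fun x y => by show ((x + y : ℕ) : ℝ) = _; push_cast; ring
  sc := fun e x => by show ((x * 2 ^ e : ℕ) : ℝ) = _; push_cast; ring

/-- Level 1 (lines of naturals). [folklore] -/
theorem lin1 (n : ℕ) (s3 : ℝ) : IsLin2 (fun ln : T1 => bvF (fun x : ℕ => (x : ℝ)) 0 n ln s3) [] add1 sc1 where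
  zero := by simp [bvF]
  add := fun x y => bvF_lzip (F := fun w : ℕ => (w : ℝ)) (z := 0) (add := Nat.add) lin0.zero lin0.add n s3 x y
  sc := fun e x => bvF_map (F := fun w : ℕ => (w : ℝ)) (z := 0) (F' := fun w : ℕ => (w : ℝ)) (z' := 0)
    (sc0 e) (2 ^ e) (by simp [sc0]) (fun w => lin0.sc e w) n s3 x

/-- Level 2 (slices of naturals). [folklore] -/
theorem lin2 (n : ℕ) (s2 s3 : ℝ) :
    IsLin2 (fun sl : T2 => bvF (fun ln : T1 => bvF (fun x : ℕ => (x : ℝ)) 0 n ln s3) [] n sl s2) [] add2 sc2 where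
  zero := by simp [bvF]
  add := fun x y => bvF_lzip (F := fun ln : T1 => bvF (fun w : ℕ => (w : ℝ)) 0 n ln s3) (z := []) (add := add1)
    (lin1 n s3).zero (lin1 n s3).add n s2 x y
  sc := fun e x => bvF_map (F := fun ln : T1 => bvF (fun w : ℕ => (w : ℝ)) 0 n ln s3) (z := [])
    (F' := fun ln : T1 => bvF (fun w : ℕ => (w : ℝ)) 0 n ln s3) (z' := []) (sc1 e) (2 ^ e) rfl
    (fun w => (lin1 n s3).sc e w) n s2 x

/-- Level 0 (rationals). [folklore] -/
theorem linQ0 : IsLin (fun q : ℚ => (q : ℝ)) 0 (· + ·) (· * ·) where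
  zero := by simp
  add := fun x y => by push_cast; ring
  smul := fun c x => by push_cast; ring

/-- Level 1 (rational lines). [folklore] -/
theorem linQ1 (n : ℕ) (s3 : ℝ) : IsLin (fun ln : QT1 => bvF (fun q : ℚ => (q : ℝ)) 0 n ln s3) [] qadd1 qsmul1 where
  zero := by simp [bvF]
  add := fun x y => bvF_lzip (F := fun q : ℚ => (q : ℝ)) (z := 0) (add := (· + ·)) linQ0.zero linQ0.add n s3 x y
  smul := fun c x => bvF_map (F := fun q : ℚ => (q : ℝ)) (z := 0) (F' := fun q : ℚ => (q : ℝ)) (z' := 0)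
    (c * ·) (c : ℝ) (by simp) (fun w => by push_cast; ring) n s3 x

/-- Level 2 (rational slices). [folklore] -/
theorem linQ2 (n : ℕ) (s2 s3 : ℝ) :
    IsLin (fun sl : QT2 => bvF (fun ln : QT1 => bvF (fun q : ℚ => (q : ℝ)) 0 n ln s3) [] n sl s2) [] qadd2 qsmul2 where
  zero := by simp [bvF]
  add := fun x y => bvF_lzip (F := fun ln : QT1 => bvF (fun q : ℚ => (q : ℝ)) 0 n ln s3) (z := []) (add := qadd1)
    (linQ1 n s3).zero (linQ1 n s3).add n s2 x y
  smul := fun c x => bvF_map (F := fun ln : QT1 => bvF (fun q : ℚ => (q : ℝ)) 0 n ln s3) (z := [])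
    (F' := fun ln : QT1 => bvF (fun q : ℚ => (q : ℝ)) 0 n ln s3) (z' := []) (qsmul1 c) (c : ℝ) rfl
    (fun w => (linQ1 n s3).smul c w) n s2 x

/-! ### Shapes are preserved by the splits -/

section Shapes

/-- Line predicate. [folklore] -/
def P1 (n : ℕ) (ln : T1) : Prop := ln.length = n + 1
/-- Slice predicate. [folklore] -/
def P2 (n : ℕ) (sl : T2) : Prop := sl.length = n + 1 ∧ ∀ ln ∈ sl, P1 n ln

/-- `add1` preserves the line length. [folklore] -/
theorem add1_P1 (n : ℕ) (a b : T1) (ha : P1 n a) (hb : P1 n b) : P1 n (add1 a b) :=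
  lzip_length _ a b _ ha hb

/-- `sc1` preserves the line length. [folklore] -/
theorem sc1_P1 (n e : ℕ) (a : T1) (ha : P1 n a) : P1 n (sc1 e a) := by
  unfold P1 sc1 at *; rw [List.length_map, ha]

/-- `add2` preserves the slice shape. [folklore] -/
theorem add2_P2 (n : ℕ) (a b : T2) (ha : P2 n a) (hb : P2 n b) : P2 n (add2 a b) :=
  ⟨lzip_length _ a b _ ha.1 hb.1, lzip_forall add1 (P1 n) (add1_P1 n) a b ha.2 hb.2⟩

/-- `sc2` preserves the slice shape. [folklore] -/
theorem sc2_P2 (n e : ℕ) (a : T2) (ha : P2 n a) : P2 n (sc2 e a) := by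
  refine ⟨by unfold sc2; rw [List.length_map, ha.1], fun ln hln => ?_⟩
  unfold sc2 at hln
  rw [List.mem_map] at hln
  obtain ⟨ln', hln', rfl⟩ := hln
  exact sc1_P1 n e ln' (ha.2 ln' hln')

/-- `Shape3` in terms of `P2`. [folklore] -/
theorem shape3_iff (n : ℕ) (Z : T3) : Shape3 n Z ↔ Z.length = n + 1 ∧ ∀ sl ∈ Z, P2 n sl := Iff.rfl

/-- The left child has the parent's shape. [folklore] -/
theorem shape3_splitL (n ax : ℕ) (Z : T3) (hZ : Shape3 n Z) : Shape3 n (splitL ax Z) := by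
  rw [shape3_iff] at hZ ⊢
  match ax with
  | 0 =>
    exact ⟨by simp only [splitL]; rw [castL_length, hZ.1],
      castL_forall add2 sc2 (P2 n) (add2_P2 n) (sc2_P2 n) Z hZ.2⟩
  | 1 =>
    refine ⟨by simp only [splitL, List.length_map, hZ.1], fun sl hsl => ?_⟩
    simp only [splitL, List.mem_map] at hsl
    obtain ⟨sl', hsl', rfl⟩ := hsl
    exact ⟨by rw [castL_length]; exact (hZ.2 sl' hsl').1,
      castL_forall add1 sc1 (P1 n) (add1_P1 n) (sc1_P1 n) sl' (hZ.2 sl' hsl').2⟩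
  | k + 2 =>
    refine ⟨by simp only [splitL, List.length_map, hZ.1], fun sl hsl => ?_⟩
    simp only [splitL, List.mem_map] at hsl
    obtain ⟨sl', hsl', rfl⟩ := hsl
    refine ⟨by rw [List.length_map]; exact (hZ.2 sl' hsl').1, fun ln hln => ?_⟩
    rw [List.mem_map] at hln
    obtain ⟨ln', hln', rfl⟩ := hln
    unfold P1; rw [castL_length]; exact (hZ.2 sl' hsl').2 ln' hln'

/-- The right child has the parent's shape. [folklore] -/
theorem shape3_splitR (n ax : ℕ) (Z : T3) (hZ : Shape3 n Z) : Shape3 n (splitR ax Z) := by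
  rw [shape3_iff] at hZ ⊢
  match ax with
  | 0 =>
    exact ⟨by simp only [splitR]; rw [castR_length, hZ.1],
      castR_forall add2 sc2 (P2 n) (add2_P2 n) (sc2_P2 n) Z hZ.2⟩
  | 1 =>
    refine ⟨by simp only [splitR, List.length_map, hZ.1], fun sl hsl => ?_⟩
    simp only [splitR, List.mem_map] at hsl
    obtain ⟨sl', hsl', rfl⟩ := hsl
    exact ⟨by rw [castR_length]; exact (hZ.2 sl' hsl').1,
      castR_forall add1 sc1 (P1 n) (add1_P1 n) (sc1_P1 n) sl' (hZ.2 sl' hsl').2⟩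
  | k + 2 =>
    refine ⟨by simp only [splitR, List.length_map, hZ.1], fun sl hsl => ?_⟩
    simp only [splitR, List.mem_map] at hsl
    obtain ⟨sl', hsl', rfl⟩ := hsl
    refine ⟨by rw [List.length_map]; exact (hZ.2 sl' hsl').1, fun ln hln => ?_⟩
    rw [List.mem_map] at hln
    obtain ⟨ln', hln', rfl⟩ := hln
    unfold P1; rw [castR_length]; exact (hZ.2 sl' hsl').2 ln' hln'

end Shapes

/-- `castL [] = []`. [folklore] -/
theorem castL_nil {α : Type} (add : α → α → α) (sc : ℕ → α → α) : castL add sc ([] : List α) = [] := rfl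
/-- `castR [] = []`. [folklore] -/
theorem castR_nil {α : Type} (add : α → α → α) (sc : ℕ → α → α) : castR add sc ([] : List α) = [] := rfl

/-! ### Values of the children -/

section Split
variable (n : ℕ)

/-- Axis `u`, left: `val3 (splitL 0 Z) (2s₁) = 2ⁿ val3 Z s₁`. [folklore] -/
theorem val3N_splitL0 (Z : T3) (hZ : Shape3 n Z) (s1 s2 s3 : ℝ) :
    val3N n (splitL 0 Z) (2 * s1) s2 s3 = 2 ^ n * val3N n Z s1 s2 s3 := by
  unfold val3N; simp only [splitL]
  rw [bvF_castL (lin2 n s2 s3) n Z hZ.1]; congr 2; ring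

/-- Axis `u`, right: `val3 (splitR 0 Z) (2s₁ - 1) = 2ⁿ val3 Z s₁`. [folklore] -/
theorem val3N_splitR0 (Z : T3) (hZ : Shape3 n Z) (s1 s2 s3 : ℝ) :
    val3N n (splitR 0 Z) (2 * s1 - 1) s2 s3 = 2 ^ n * val3N n Z s1 s2 s3 := by
  unfold val3N; simp only [splitR]
  rw [bvF_castR (lin2 n s2 s3) n Z hZ.1]; congr 2; ring

/-- Axis `v`, left. [folklore] -/
theorem val3N_splitL1 (Z : T3) (hZ : Shape3 n Z) (s1 s2 s3 : ℝ) :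
    val3N n (splitL 1 Z) s1 (2 * s2) s3 = 2 ^ n * val3N n Z s1 s2 s3 := by
  unfold val3N; simp only [splitL]
  rw [bvF_map_mem (F := (fun sl : T2 => bvF (fun ln : T1 => bvF (fun w : ℕ => (w : ℝ)) 0 n ln s3) [] n sl (2 * s2))) (z := [])
    (F' := (fun sl : T2 => bvF (fun ln : T1 => bvF (fun w : ℕ => (w : ℝ)) 0 n ln s3) [] n sl s2)) (z' := []) (castL add1 sc1) (2 ^ n)
    (by simp [bvF]) (by simp [bvF]) n s1 Z]
  intro sl hsl
  show bvF _ [] n (castL add1 sc1 sl) (2 * s2) = _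
  rw [bvF_castL (lin1 n s3) n sl (hZ.2 sl hsl).1]; congr 2; ring

/-- Axis `v`, right. [folklore] -/
theorem val3N_splitR1 (Z : T3) (hZ : Shape3 n Z) (s1 s2 s3 : ℝ) :
    val3N n (splitR 1 Z) s1 (2 * s2 - 1) s3 = 2 ^ n * val3N n Z s1 s2 s3 := by
  unfold val3N; simp only [splitR]
  rw [bvF_map_mem (F := (fun sl : T2 => bvF (fun ln : T1 => bvF (fun w : ℕ => (w : ℝ)) 0 n ln s3) [] n sl (2 * s2 - 1))) (z := [])
    (F' := (fun sl : T2 => bvF (fun ln : T1 => bvF (fun w : ℕ => (w : ℝ)) 0 n ln s3) [] n sl s2)) (z' := []) (castR add1 sc1) (2 ^ n)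
    (by simp [bvF]) (by simp [bvF]) n s1 Z]
  intro sl hsl
  show bvF _ [] n (castR add1 sc1 sl) (2 * s2 - 1) = _
  rw [bvF_castR (lin1 n s3) n sl (hZ.2 sl hsl).1]; congr 2; ring

/-- Axis `t`, left. [folklore] -/
theorem val3N_splitL2 (k : ℕ) (Z : T3) (hZ : Shape3 n Z) (s1 s2 s3 : ℝ) :
    val3N n (splitL (k + 2) Z) s1 s2 (2 * s3) = 2 ^ n * val3N n Z s1 s2 s3 := by
  unfold val3N; simp only [splitL]
  rw [bvF_map_mem (F := (fun sl : T2 => bvF (fun ln : T1 => bvF (fun w : ℕ => (w : ℝ)) 0 n ln (2 * s3)) [] n sl s2)) (z := [])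
    (F' := (fun sl : T2 => bvF (fun ln : T1 => bvF (fun w : ℕ => (w : ℝ)) 0 n ln s3) [] n sl s2)) (z' := []) (List.map (castL Nat.add sc0)) (2 ^ n)
    (by simp [bvF]) (by simp [bvF]) n s1 Z]
  intro sl hsl
  show bvF _ [] n (sl.map (castL Nat.add sc0)) s2 = _
  rw [bvF_map_mem (F := fun ln : T1 => bvF (fun w : ℕ => (w : ℝ)) 0 n ln (2 * s3)) (z := [])
    (F' := fun ln : T1 => bvF (fun w : ℕ => (w : ℝ)) 0 n ln s3) (z' := []) (castL Nat.add sc0) (2 ^ n)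
    (by simp [bvF]) (by simp [bvF]) n s2 sl]
  intro ln hln
  show bvF _ 0 n (castL Nat.add sc0 ln) (2 * s3) = _
  rw [bvF_castL lin0 n ln ((hZ.2 sl hsl).2 ln hln)]; congr 2; ring

/-- Axis `t`, right. [folklore] -/
theorem val3N_splitR2 (k : ℕ) (Z : T3) (hZ : Shape3 n Z) (s1 s2 s3 : ℝ) :
    val3N n (splitR (k + 2) Z) s1 s2 (2 * s3 - 1) = 2 ^ n * val3N n Z s1 s2 s3 := by
  unfold val3N; simp only [splitR]
  rw [bvF_map_mem (F := (fun sl : T2 => bvF (fun ln : T1 => bvF (fun w : ℕ => (w : ℝ)) 0 n ln (2 * s3 - 1)) [] n sl s2)) (z := [])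
    (F' := (fun sl : T2 => bvF (fun ln : T1 => bvF (fun w : ℕ => (w : ℝ)) 0 n ln s3) [] n sl s2)) (z' := []) (List.map (castR Nat.add sc0)) (2 ^ n)
    (by simp [bvF]) (by simp [bvF]) n s1 Z]
  intro sl hsl
  show bvF _ [] n (sl.map (castR Nat.add sc0)) s2 = _
  rw [bvF_map_mem (F := fun ln : T1 => bvF (fun w : ℕ => (w : ℝ)) 0 n ln (2 * s3 - 1)) (z := [])
    (F' := fun ln : T1 => bvF (fun w : ℕ => (w : ℝ)) 0 n ln s3) (z' := []) (castR Nat.add sc0) (2 ^ n)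
    (by simp [bvF]) (by simp [bvF]) n s2 sl]
  intro ln hln
  show bvF _ 0 n (castR Nat.add sc0 ln) (2 * s3 - 1) = _
  rw [bvF_castR lin0 n ln ((hZ.2 sl hsl).2 ln hln)]; congr 2; ring

end Split

/-! ### Sign tests -/

/-- All entries `≥ θ` ⇒ value `≥ θ` on the cube. [folklore] -/
theorem le_val3N_of_allGe3 (n : ℕ) (Z : T3) (hZ : Shape3 n Z) (θ : ℕ) (h : allGe3 θ Z = true)
    {s1 s2 s3 : ℝ} (h10 : 0 ≤ s1) (h11 : s1 ≤ 1) (h20 : 0 ≤ s2) (h21 : s2 ≤ 1) (h30 : 0 ≤ s3) (h31 : s3 ≤ 1) :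
    (θ : ℝ) ≤ val3N n Z s1 s2 s3 := by
  simp only [allGe3, List.all_eq_true, Nat.ble_eq] at h
  unfold val3N
  refine le_bvF_of_forall n Z (θ : ℝ) (fun a ha => ?_) h10 h11
  have hsl := getD_mem_of_lt Z [] (by rw [hZ.1]; omega : a < Z.length)
  refine le_bvF_of_forall n _ (θ : ℝ) (fun b hb => ?_) h20 h21
  have hln := getD_mem_of_lt (Z.getD a []) [] (by rw [(hZ.2 _ hsl).1]; omega : b < (Z.getD a []).length)
  refine le_bvF_of_forall n _ (θ : ℝ) (fun c hc => ?_) h30 h31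
  have hx := getD_mem_of_lt ((Z.getD a []).getD b []) 0
    (by rw [(hZ.2 _ hsl).2 _ hln]; omega : c < ((Z.getD a []).getD b []).length)
  exact_mod_cast h _ hsl _ hln _ hx

/-- All entries `< η` ⇒ value `< η` on the cube. [folklore] -/
theorem val3N_lt_of_allLt3 (n : ℕ) (Z : T3) (hZ : Shape3 n Z) (η : ℕ) (h : allLt3 η Z = true)
    {s1 s2 s3 : ℝ} (h10 : 0 ≤ s1) (h11 : s1 ≤ 1) (h20 : 0 ≤ s2) (h21 : s2 ≤ 1) (h30 : 0 ≤ s3) (h31 : s3 ≤ 1) :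
    val3N n Z s1 s2 s3 < η := by
  simp only [allLt3, List.all_eq_true, Nat.blt_eq] at h
  have hmain : val3N n Z s1 s2 s3 ≤ (η : ℝ) - 1 := by
    unfold val3N
    refine bvF_le_of_forall n Z ((η : ℝ) - 1) (fun a ha => ?_) h10 h11
    have hsl := getD_mem_of_lt Z [] (by rw [hZ.1]; omega : a < Z.length)
    refine bvF_le_of_forall n _ ((η : ℝ) - 1) (fun b hb => ?_) h20 h21
    have hln := getD_mem_of_lt (Z.getD a []) [] (by rw [(hZ.2 _ hsl).1]; omega : b < (Z.getD a []).length)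
    refine bvF_le_of_forall n _ ((η : ℝ) - 1) (fun c hc => ?_) h30 h31
    have hx := getD_mem_of_lt ((Z.getD a []).getD b []) 0
      (by rw [(hZ.2 _ hsl).2 _ hln]; omega : c < ((Z.getD a []).getD b []).length)
    have hlt := h _ hsl _ hln _ hx
    have : (((Z.getD a []).getD b []).getD c 0 : ℝ) + 1 ≤ η := by exact_mod_cast hlt
    linarith
  linarith

/-! ### Soundness of the search -/

/-- One split step, abstractly: if both halves of the parameter interval are certified (with thresholds scaled
by `2^nY`, `2^nH`), the node is certified. [folklore] -/
theorem split_step (nY nH θ η : ℕ) (VY VH VYL VHL VYR VHR : ℝ → ℝ)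
    (eYL : ∀ s, VYL (2 * s) = 2 ^ nY * VY s) (eHL : ∀ s, VHL (2 * s) = 2 ^ nH * VH s)
    (eYR : ∀ s, VYR (2 * s - 1) = 2 ^ nY * VY s) (eHR : ∀ s, VHR (2 * s - 1) = 2 ^ nH * VH s)
    (hL : ∀ s', 0 ≤ s' → s' ≤ 1 → ((sc0 nH η : ℕ) : ℝ) ≤ VHL s' → ((sc0 nY θ : ℕ) : ℝ) ≤ VYL s')
    (hR : ∀ s', 0 ≤ s' → s' ≤ 1 → ((sc0 nH η : ℕ) : ℝ) ≤ VHR s' → ((sc0 nY θ : ℕ) : ℝ) ≤ VYR s')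
    (s : ℝ) (h0 : 0 ≤ s) (h1 : s ≤ 1) (hH : (η : ℝ) ≤ VH s) : (θ : ℝ) ≤ VY s := by
  have cθ : ((sc0 nY θ : ℕ) : ℝ) = 2 ^ nY * θ := by
    rw [show sc0 nY θ = θ * 2 ^ nY from rfl]; push_cast; ring
  have cη : ((sc0 nH η : ℕ) : ℝ) = 2 ^ nH * η := by
    rw [show sc0 nH η = η * 2 ^ nH from rfl]; push_cast; ring
  have pY : (0 : ℝ) < 2 ^ nY := by positivity
  have pH : (0 : ℝ) < 2 ^ nH := by positivity
  by_cases hs : s ≤ 1 / 2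
  · have h := hL (2 * s) (by linarith) (by linarith)
      (by rw [cη, eHL]; exact mul_le_mul_of_nonneg_left hH pH.le)
    rw [cθ, eYL] at h
    exact le_of_mul_le_mul_left h pY
  · push Not at hs
    have h := hR (2 * s - 1) (by linarith) (by linarith)
      (by rw [cη, eHR]; exact mul_le_mul_of_nonneg_left hH pH.le)
    rw [cθ, eYR] at h
    exact le_of_mul_le_mul_left h pY

set_option maxHeartbeats 800000 in
/-- **Soundness of the branch and bound**: on a certified node, wherever (in the unit cube) the
`H`-value is `≥ η`, the `Y`-value is `≥ θ`. [folklore] -/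
theorem bnb_sound (nY nH : ℕ) : ∀ (fuel ax : ℕ) (Y : T3) (θ : ℕ) (H : T3) (η : ℕ),
    bnb nY nH fuel ax Y θ H η = true → Shape3 nY Y → Shape3 nH H →
    ∀ s1 s2 s3 : ℝ, 0 ≤ s1 → s1 ≤ 1 → 0 ≤ s2 → s2 ≤ 1 → 0 ≤ s3 → s3 ≤ 1 →
      (η : ℝ) ≤ val3N nH H s1 s2 s3 → (θ : ℝ) ≤ val3N nY Y s1 s2 s3 := by
  intro fuel
  induction fuel with
  | zero => intro ax Y θ H η h; simp [bnb] at h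
  | succ fuel ih =>
    intro ax Y θ H η h hY hH s1 s2 s3 h10 h11 h20 h21 h30 h31 hval
    simp only [bnb, Bool.or_eq_true, Bool.and_eq_true] at h
    rcases h with hge | hlt | ⟨hl, hr⟩
    · exact le_val3N_of_allGe3 nY Y hY θ hge h10 h11 h20 h21 h30 h31
    · exact absurd hval (not_le.2 (val3N_lt_of_allLt3 nH H hH η hlt h10 h11 h20 h21 h30 h31))
    · have ihL := ih _ _ _ _ _ hl (shape3_splitL nY ax Y hY) (shape3_splitL nH ax H hH)
      have ihR := ih _ _ _ _ _ hr (shape3_splitR nY ax Y hY) (shape3_splitR nH ax H hH)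
      match ax with
      | 0 =>
        exact split_step nY nH θ η (fun x => val3N nY Y x s2 s3) (fun x => val3N nH H x s2 s3)
          (fun x => val3N nY (splitL 0 Y) x s2 s3) (fun x => val3N nH (splitL 0 H) x s2 s3)
          (fun x => val3N nY (splitR 0 Y) x s2 s3) (fun x => val3N nH (splitR 0 H) x s2 s3)
          (fun x => val3N_splitL0 nY Y hY x s2 s3) (fun x => val3N_splitL0 nH H hH x s2 s3)
          (fun x => val3N_splitR0 nY Y hY x s2 s3) (fun x => val3N_splitR0 nH H hH x s2 s3)
          (fun s' h0' h1' hv => ihL s' s2 s3 h0' h1' h20 h21 h30 h31 hv)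
          (fun s' h0' h1' hv => ihR s' s2 s3 h0' h1' h20 h21 h30 h31 hv) s1 h10 h11 hval
      | 1 =>
        exact split_step nY nH θ η (fun x => val3N nY Y s1 x s3) (fun x => val3N nH H s1 x s3)
          (fun x => val3N nY (splitL 1 Y) s1 x s3) (fun x => val3N nH (splitL 1 H) s1 x s3)
          (fun x => val3N nY (splitR 1 Y) s1 x s3) (fun x => val3N nH (splitR 1 H) s1 x s3)
          (fun x => val3N_splitL1 nY Y hY s1 x s3) (fun x => val3N_splitL1 nH H hH s1 x s3)
          (fun x => val3N_splitR1 nY Y hY s1 x s3) (fun x => val3N_splitR1 nH H hH s1 x s3)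
          (fun s' h0' h1' hv => ihL s1 s' s3 h10 h11 h0' h1' h30 h31 hv)
          (fun s' h0' h1' hv => ihR s1 s' s3 h10 h11 h0' h1' h30 h31 hv) s2 h20 h21 hval
      | k + 2 =>
        exact split_step nY nH θ η (fun x => val3N nY Y s1 s2 x) (fun x => val3N nH H s1 s2 x)
          (fun x => val3N nY (splitL (k + 2) Y) s1 s2 x) (fun x => val3N nH (splitL (k + 2) H) s1 s2 x)
          (fun x => val3N nY (splitR (k + 2) Y) s1 s2 x) (fun x => val3N nH (splitR (k + 2) H) s1 s2 x)
          (fun x => val3N_splitL2 nY k Y hY s1 s2 x) (fun x => val3N_splitL2 nH k H hH s1 s2 x)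
          (fun x => val3N_splitR2 nY k Y hY s1 s2 x) (fun x => val3N_splitR2 nH k H hH s1 s2 x)
          (fun s' h0' h1' hv => ihL s1 s2 s' h10 h11 h20 h21 h0' h1' hv)
          (fun s' h0' h1' hv => ihR s1 s2 s' h10 h11 h20 h21 h0' h1' hv) s3 h30 h31 hval

end Summit.Ventures.Crystal3D.CapCut.Bern
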